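import Summits.CriticalPhenomena.PercolationContinuityZ3.Theorems.Transplant.PlanarSkeletonFrmFromDefs
import Summits.CriticalPhenomena.PercolationContinuityZ3.Theorems.Transplant.SkelFrmFromBParamsKitS
import Summits.CriticalPhenomena.PercolationContinuityZ3.Theorems.Transplant.SkelFrmBParamsKitS
import Summits.CriticalPhenomena.PercolationContinuityZ3.Theorems.Transplant.SkelFrmFrom1ParamsPO
import Summits.CriticalPhenomena.PercolationContinuityZ3.Theorems.Transplant.SkelFrm1ParamsPO
import HarnessLib
import Summits.CriticalPhenomena.PercolationContinuityZ3.Theorems.Transplant.SkelFrmBChoiceNums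
/-!
# U-WAVE PORT (RULING D-U, lead g21 2026-08-26; WAVE-U-MANIFEST v3.0 row «SkelFrmBChoiceNums» ↦ «SkelFrmFromBChoiceNums») of the tree module
# `Transplant/SkelFrmBChoiceNums` onto the carrier `PlanarSkeletonFrmFrom` (frames only, cylinders connected from width `ℓ₀` on)

ORIGINAL TITLE: N2 (frames-only node `SamePDropOfSkeletonFrm₁`, OPEN) — (ζ″) ledger, THE (S0) KIT-CONSTANT NUMBERS `NegB.KS0`: the kit block of the (C) residue

builds on p205010 (kernel theorem, internal audit signed; external expert review pending) — nothing in this file uses p205010; NOTHING is claimed about the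
OPEN node U `SamePDropOfSkeletonFrmFrom₁` (nor U_s / the end state).  Lane `prim-bschramm`, seat `prim-bschramm-p3` gen 26; helper file
(`--supports stmt-CriticalPhenomena-4575 --as helper`).  PORT RULES r1–r4 of RULING D-U: declaration order and proof texts are those of the original,
byte-identical except (i) the carrier token `PlanarSkeletonFrm ↦ PlanarSkeletonFrmFrom` (binders, `namespace`/`end` lines, qualified names of twinned
declarations), (ii) carrier-FREE declarations of the original (φ-level `Skelφ…` blocks and namespace-only arithmetic residents) are NOT re-declared —
this file imports the original and `export`s the twin-free residents (POLICY T / treatment (m1)); residents whose statement mentions a twinned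
constant are copied, (iii) every carrier-binding declaration keeps its explicit binder `(Φ : PlanarSkeletonFrmFrom G)` in its own signature (r2).  Docstrings and citations are the original's.
-/

noncomputable section

open scoped Classical

namespace Summit.CriticalPhenomena.PercolationContinuityZ3.Theorems.Transplant

namespace PlanarSkeletonFrmFrom

namespace NegB

namespace KS0

open Literature.Probability.Percolation Literature.Probability.LatticeModels SimpleGraph
open Literature.Barriers.CriticalPhenomena (graphBall)
open SkelConc (Consts)
open BoxProdZ2 (kitK kitN kitL)
open SkelI (tanOff)
open Skelφ.StepI (DataN)
open Neg

/-! ## §1 The (S0) kit constants (no apron) -/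

section Consts

/-- **The tangential clamp surplus of the (S0) kit** `M0 := KCmax + Rs` (N1's `Ma` without the apron summands `Kmax + W + 2`). [this work] -/
def M0 {V : Type} (t : V) (D : Skelφ.StepI.DataNS V) (mk : ℕ) : ℕ := KS.KCmax t D mk + KS.Rs t D mk

/-- **The first kit level** `T0 := Dsh + M0 = tanOff ℓsa M0`. [this work] -/
def T0 {V : Type} (t : V) (D : Skelφ.StepI.DataNS V) (mk : ℕ) : ℕ := KS.Dsh t D mk + M0 t D mk

/-- `T0 = tanOff ℓsa M0`. [folklore] -/
theorem T0_eq {V : Type} (t : V) (D : Skelφ.StepI.DataNS V) (mk : ℕ) : T0 t D mk = tanOff (KS.ℓsa t D mk) (M0 t D mk) := by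
  unfold T0 tanOff; rw [KS.Dsh_eq]

/-- `T0 = Dsh + KCmax + Rs` (the (S0) `hT` row with equality). [folklore] -/
theorem T0_eq' {V : Type} (t : V) (D : Skelφ.StepI.DataNS V) (mk : ℕ) : T0 t D mk = KS.Dsh t D mk + KS.KCmax t D mk + KS.Rs t D mk := by
  unfold T0 M0; omega

/-- **The kit reach** `reach0 := 13·(T0+1) + 13·d + KCmax`. [this work] -/
def reach0 {V : Type} (t : V) (D : Skelφ.StepI.DataNS V) (mk : ℕ) : ℕ := 13 * (T0 t D mk + 1) + 13 * KS.da t D mk + KS.KCmax t D mk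

/-- **The near/far base** `base0 := 13·(T0+2) + 13·d + (KCmax + Rs)` (`r₀ ≥ base0`). [this work] -/
def base0 {V : Type} (t : V) (D : Skelφ.StepI.DataNS V) (mk : ℕ) : ℕ := 13 * (T0 t D mk + 2) + 13 * KS.da t D mk + (KS.KCmax t D mk + KS.Rs t D mk)

/-- **The seed radius** `rs0 := 1 + base0`. [this work] -/
def rs0 {V : Type} (t : V) (D : Skelφ.StepI.DataNS V) (mk : ℕ) : ℕ := 1 + base0 t D mk

/-- **The Step-III region-size bound** `cS0 := 14·(T0+1) + 14·d + (KCmax + 1) + cU`. [this work] -/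
def cS0 {V : Type} {G : SimpleGraph V} [G.LocallyFinite] (Φ : PlanarSkeletonFrmFrom G) (t : V) (D : Skelφ.StepI.DataNS V) (mk : ℕ) : ℕ :=
  14 * (T0 t D mk + 1) + 14 * KS.da t D mk + (KS.KCmax t D mk + 1) + KS.cUA Φ t D mk

/-- **The Step-III seed-size bound** `sB0 := 1 + Δ·cS0 + cS0·cU` (the exponent of the (S0) `hk` row). [this work] -/
def sB0 {V : Type} {G : SimpleGraph V} [G.LocallyFinite] (Φ : PlanarSkeletonFrmFrom G) (t : V) (D : Skelφ.StepI.DataNS V) (mk : ℕ) : ℕ :=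
  1 + Φ.Δ * cS0 Φ t D mk + cS0 Φ t D mk * KS.cUA Φ t D mk

/-- **The contact multiplier** `B0 := (Δ+1)^{2·rs0}`. [this work] -/
def B0 {V : Type} {G : SimpleGraph V} [G.LocallyFinite] (Φ : PlanarSkeletonFrmFrom G) (t : V) (D : Skelφ.StepI.DataNS V) (mk : ℕ) : ℕ := (Φ.Δ + 1) ^ (2 * rs0 t D mk)

/-- **THE (S0) KIT RECORD** `kit0 := ⟨13, ℓsa, M0, d, W := 0, ℓ := 1, R′ := 0, A, r₀⟩` (no apron: `W`, `R′` unused); `A` per frame, `r₀` a late slot. [this work] -/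
def kit0 {V : Type} (t : V) (D : Skelφ.StepI.DataNS V) (mk : ℕ) (A : ℤ) (r₀ : ℕ) : Skelφ.ApronPrm := ⟨13, KS.ℓsa t D mk, M0 t D mk, KS.da t D mk, 0, 1, 0, A, r₀⟩

/-- The fields of `kit0` by name (all `rfl`). [folklore] -/
theorem kit0_fields {V : Type} (t : V) (D : Skelφ.StepI.DataNS V) (mk : ℕ) (A : ℤ) (r₀ : ℕ) :
    (kit0 t D mk A r₀).N = 13 ∧ (kit0 t D mk A r₀).ℓs = KS.ℓsa t D mk ∧ (kit0 t D mk A r₀).M = M0 t D mk ∧ (kit0 t D mk A r₀).d = KS.da t D mk ∧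
      (kit0 t D mk A r₀).A = A ∧ (kit0 t D mk A r₀).r₀ = r₀ := ⟨rfl, rfl, rfl, rfl, rfl, rfl⟩

/-- `shellD kit0 = Dsh`. [folklore] -/
theorem shellD_kit0 {V : Type} (t : V) (D : Skelφ.StepI.DataNS V) (mk : ℕ) (A : ℤ) (r₀ : ℕ) : Skelφ.shellD (kit0 t D mk A r₀) = KS.Dsh t D mk := by
  unfold Skelφ.shellD kit0; rw [KS.Dsh_eq]

/-- `tanOff kit0.ℓs kit0.M = T0`. [folklore] -/
theorem tanOff_kit0 {V : Type} (t : V) (D : Skelφ.StepI.DataNS V) (mk : ℕ) (A : ℤ) (r₀ : ℕ) : tanOff (kit0 t D mk A r₀).ℓs (kit0 t D mk A r₀).M = T0 t D mk :=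
  (T0_eq t D mk).symm

/-- **THE CONSTANT INEQUALITIES OF THE (S0) CLAUSES** for `kit0` and shear constant `kq ≤ 10` (`|h| ≤ 10n`): `hPN` (`kq + 3 ≤ N`), `hdD` (`d + 2 ≤ shellD`), `hDρ`
(`Rs + 1 ≤ shellD`), `hKCmax` (`(shellD + M_u + 1)(kq + 1) ≤ KCmax`), `hT` (`shellD + KCmax + Rs ≤ tanOff ℓs M`), and `1 ≤ N` (bridge kit). [folklore] -/
theorem kit0_ok {V : Type} (t : V) (D : Skelφ.StepI.DataNS V) (mk : ℕ) (A : ℤ) (r₀ : ℕ) {kq : ℕ} (hkq : kq ≤ 10) :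
    kq + 3 ≤ (kit0 t D mk A r₀).N ∧
    (kit0 t D mk A r₀).d + 2 ≤ Skelφ.shellD (kit0 t D mk A r₀) ∧
    KS.Rs t D mk + 1 ≤ Skelφ.shellD (kit0 t D mk A r₀) ∧
    (Skelφ.shellD (kit0 t D mk A r₀) + Mu D + 1) * (kq + 1) ≤ KS.KCmax t D mk ∧
    (Skelφ.shellD (kit0 t D mk A r₀) : ℤ) + KS.KCmax t D mk + KS.Rs t D mk ≤ tanOff (kit0 t D mk A r₀).ℓs (kit0 t D mk A r₀).M ∧
    1 ≤ (kit0 t D mk A r₀).N := by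
  rw [shellD_kit0, tanOff_kit0]
  simp only [kit0]
  refine ⟨by omega, ?_, KS.hDρ_at t D mk, KS.hKCmax_at t D mk (by omega), ?_, by omega⟩
  · have := KS.hD2_at t D mk; omega
  · rw [T0_eq']; push_cast; omega

/-- **The size inequalities for `kit0`**: `hrs` (`1 + (13(T0+2) + 13d + (KCmax+Rs)) ≤ rs0`) and `hcS` (`14(T0+1) + 14d + (KCmax+1) + cU ≤ cS0`). [folklore] -/
theorem kit0_sizes {V : Type} {G : SimpleGraph V} [G.LocallyFinite] (Φ : PlanarSkeletonFrmFrom G) (t : V) (D : Skelφ.StepI.DataNS V) (mk : ℕ) (A : ℤ) (r₀ : ℕ) :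
    1 + ((kit0 t D mk A r₀).N * (tanOff (kit0 t D mk A r₀).ℓs (kit0 t D mk A r₀).M + 2) + (kit0 t D mk A r₀).N * (kit0 t D mk A r₀).d +
        (KS.KCmax t D mk + KS.Rs t D mk)) ≤ rs0 t D mk ∧
    ((kit0 t D mk A r₀).N + 1) * (tanOff (kit0 t D mk A r₀).ℓs (kit0 t D mk A r₀).M + 1) + ((kit0 t D mk A r₀).N + 1) * (kit0 t D mk A r₀).d +
        (KS.KCmax t D mk + 1) + KS.cUA Φ t D mk ≤ cS0 Φ t D mk := by
  rw [tanOff_kit0]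
  simp only [kit0]
  exact ⟨by unfold rs0 base0; omega, by unfold cS0; omega⟩

/-- **`hr₀`/`hr₀1` for `kit0`**: any `r₀ ≥ base0` satisfies `13(T0+2) + 13d + (KCmax+Rs) ≤ r₀` and `1 ≤ r₀`. [folklore] -/
theorem hr₀_kit0 {V : Type} (t : V) (D : Skelφ.StepI.DataNS V) (mk : ℕ) (A : ℤ) {r₀ : ℕ} (h : base0 t D mk ≤ r₀) :
    (kit0 t D mk A r₀).N * (tanOff (kit0 t D mk A r₀).ℓs (kit0 t D mk A r₀).M + 2) + (kit0 t D mk A r₀).N * (kit0 t D mk A r₀).d +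
        (KS.KCmax t D mk + KS.Rs t D mk) ≤ (kit0 t D mk A r₀).r₀ ∧ 1 ≤ (kit0 t D mk A r₀).r₀ := by
  rw [tanOff_kit0]
  simp only [kit0]
  unfold base0 at h
  exact ⟨by omega, by omega⟩

/-- **`hreach` for `kit0`**: any `r₀ ≥ r + reach0` satisfies `r + (13(T0+1) + 13d + KCmax) ≤ r₀`. [folklore] -/
theorem hreach_kit0 {V : Type} (t : V) (D : Skelφ.StepI.DataNS V) (mk : ℕ) (A : ℤ) {r r₀ : ℕ} (h : r + reach0 t D mk ≤ r₀) :
    r + ((kit0 t D mk A r₀).N * (tanOff (kit0 t D mk A r₀).ℓs (kit0 t D mk A r₀).M + 1) + (kit0 t D mk A r₀).N * (kit0 t D mk A r₀).d + KS.KCmax t D mk) ≤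
      (kit0 t D mk A r₀).r₀ := by
  rw [tanOff_kit0]
  simp only [kit0]
  unfold reach0 at h; omega

/-- **The late near/far threshold** `r₀0 Rl := max base0 (Rl + reach0)` for a long-prism radius `Rl`. [this work] -/
def r₀0 {V : Type} (t : V) (D : Skelφ.StepI.DataNS V) (mk : ℕ) (Rl : ℕ) : ℕ := max (base0 t D mk) (Rl + reach0 t D mk)

/-- `base0 ≤ r₀0 Rl` and `Rl + reach0 ≤ r₀0 Rl`. [folklore] -/
theorem r₀0_ge {V : Type} (t : V) (D : Skelφ.StepI.DataNS V) (mk : ℕ) (Rl : ℕ) : base0 t D mk ≤ r₀0 t D mk Rl ∧ Rl + reach0 t D mk ≤ r₀0 t D mk Rl :=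
  ⟨le_max_left _ _, le_max_right _ _⟩

/-- **The first kit level** `j₀0 := T0`. [this work] -/
def j₀0 {V : Type} (t : V) (D : Skelφ.StepI.DataNS V) (mk : ℕ) : ℕ := T0 t D mk

/-- **The level boxes are wide enough from `j₀0` on**: `j₀0 ≤ j → 2·T0 ≤ 2j ∧ d + 2 ≤ 2j ∧ Dsh + 1 + d + KCmax + Rs ≤ 2j` (`hwide/hdw/hDw`). [folklore] -/
theorem levels_wide {V : Type} (t : V) (D : Skelφ.StepI.DataNS V) (mk : ℕ) {j : ℕ} (hj : j₀0 t D mk ≤ j) :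
    2 * T0 t D mk ≤ 2 * j ∧ KS.da t D mk + 2 ≤ 2 * j ∧ KS.Dsh t D mk + 1 + KS.da t D mk + KS.KCmax t D mk + KS.Rs t D mk ≤ 2 * j := by
  unfold j₀0 at hj
  have h1 := T0_eq' t D mk
  have h2 := KS.hD2_at t D mk
  refine ⟨by omega, by omega, by omega⟩

end Consts

/-! ## §2 The counts at the running density -/

section Counts

/-- **The number of seeds** `kk0 := kitK Δ sB0 B0 δkit p`. [this work] -/
def kk0 (κ : Consts) {V : Type} [DecidableEq V] [Countable V] {G : SimpleGraph V} [G.LocallyFinite] (Φ : PlanarSkeletonFrmFrom G) (t : V) (p : unitInterval)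
    (D : Skelφ.StepI.DataNS V) (mk : ℕ) : ℕ :=
  kitK Φ.Δ (sB0 Φ t D mk) (B0 Φ t D mk) (Neg.δkit κ Φ) p

/-- **The number of contacts** `Nk0 := kitN Δ sB0 B0 δkit p`. [this work] -/
def Nk0 (κ : Consts) {V : Type} [DecidableEq V] [Countable V] {G : SimpleGraph V} [G.LocallyFinite] (Φ : PlanarSkeletonFrmFrom G) (t : V) (p : unitInterval)
    (D : Skelφ.StepI.DataNS V) (mk : ℕ) : ℕ :=
  kitN Φ.Δ (sB0 Φ t D mk) (B0 Φ t D mk) (Neg.δkit κ Φ) p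

/-- **The number of levels** `Lcnt0 := kitL Δ sB0 B0 δkit p`. [this work] -/
def Lcnt0 (κ : Consts) {V : Type} [DecidableEq V] [Countable V] {G : SimpleGraph V} [G.LocallyFinite] (Φ : PlanarSkeletonFrmFrom G) (t : V) (p : unitInterval)
    (D : Skelφ.StepI.DataNS V) (mk : ℕ) : ℕ :=
  kitL Φ.Δ (sB0 Φ t D mk) (B0 Φ t D mk) (Neg.δkit κ Φ) p

/-- **The last kit level** `j₁0 := T0 + Lcnt0 − 1`. [this work] -/
def j₁0 (κ : Consts) {V : Type} [DecidableEq V] [Countable V] {G : SimpleGraph V} [G.LocallyFinite] (Φ : PlanarSkeletonFrmFrom G) (t : V) (p : unitInterval)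
    (D : Skelφ.StepI.DataNS V) (mk : ℕ) : ℕ :=
  T0 t D mk + Lcnt0 κ Φ t p D mk - 1

/-- **The window depth in levels** `Rlev0 := j₁0 + reach0`. [this work] -/
def Rlev0 (κ : Consts) {V : Type} [DecidableEq V] [Countable V] {G : SimpleGraph V} [G.LocallyFinite] (Φ : PlanarSkeletonFrmFrom G) (t : V) (p : unitInterval)
    (D : Skelφ.StepI.DataNS V) (mk : ℕ) : ℕ :=
  j₁0 κ Φ t p D mk + reach0 t D mk

/-- **The kit-level displacement** `R′0 := Rlev0 + 1`. [this work] -/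
def R'0 (κ : Consts) {V : Type} [DecidableEq V] [Countable V] {G : SimpleGraph V} [G.LocallyFinite] (Φ : PlanarSkeletonFrmFrom G) (t : V) (p : unitInterval)
    (D : Skelφ.StepI.DataNS V) (mk : ℕ) : ℕ :=
  Rlev0 κ Φ t p D mk + 1

variable (κ : Consts) {V : Type} [DecidableEq V] [Countable V] {G : SimpleGraph V} [G.LocallyFinite] (Φ : PlanarSkeletonFrmFrom G) (t : V) (p : unitInterval)
  (D : Skelφ.StepI.DataNS V) (mk : ℕ)

/-- `0 < Lcnt0` (under `0 < p < 1`). [folklore] -/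
theorem Lcnt0_pos (hp0 : 0 < (p : ℝ)) (hp1 : (p : ℝ) < 1) : 0 < Lcnt0 κ Φ t p D mk := BoxProdZ2.kitL_pos _ _ _ (Neg.δkit_pos κ Φ) p hp0 hp1

/-- **`card [j₀0, j₁0] = Lcnt0`** (under `0 < p < 1`). [folklore] -/
theorem card_levels (hp0 : 0 < (p : ℝ)) (hp1 : (p : ℝ) < 1) : (Finset.Icc (j₀0 t D mk) (j₁0 κ Φ t p D mk)).card = Lcnt0 κ Φ t p D mk := by
  have := Lcnt0_pos κ Φ t p D mk hp0 hp1
  rw [Nat.card_Icc]; unfold j₁0 j₀0; omega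

/-- `j₀0 ≤ j₁0` (under `0 < p < 1`). [folklore] -/
theorem j₀0_le_j₁0 (hp0 : 0 < (p : ℝ)) (hp1 : (p : ℝ) < 1) : j₀0 t D mk ≤ j₁0 κ Φ t p D mk := by
  have := Lcnt0_pos κ Φ t p D mk hp0 hp1; unfold j₁0 j₀0; omega

/-- **`kk0·(Δ+1)^{2·rs0} ≤ Nk0`** (the `hN` row; under `0 < p < 1`). [folklore] -/
theorem hNk0_at (hp0 : 0 < (p : ℝ)) (hp1 : (p : ℝ) < 1) : kk0 κ Φ t p D mk * (Φ.Δ + 1) ^ (2 * rs0 t D mk) ≤ Nk0 κ Φ t p D mk :=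
  BoxProdZ2.kitK_mul_le_kitN _ _ _ (Neg.δkit_pos κ Φ) p hp0 hp1

/-- **THE COUNTS AT EVERY RUNNING DENSITY `q ∈ [p/2, p]` AND EVERY ACCURACY `δ′ ≥ δkit`** (`δ′ ∈ {κ.δ, κ.δ₂, κ.δr n}` by `Neg.δkit_le_δ/δ₂/δr`):
`(1 − q^{1+Δ·cS0+cS0·cU})^{kk0} ≤ δ′` (the (S0) `hk`) and `1/(1−q)^{Δ·Nk0} ≤ δ′·card [j₀0, j₁0]` (`hcount`). [cite: KozmaNitzan2024, §4 Lemma 10 Steps II–III (pp. 18–19)] -/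
theorem counts_atq (hp0 : 0 < (p : ℝ)) (hp1 : (p : ℝ) < 1) {q : unitInterval} (hq1 : (p : ℝ) / 2 ≤ q) (hq2 : (q : ℝ) ≤ p) {δ' : ℝ} (hδ' : Neg.δkit κ Φ ≤ δ') :
    (1 - (q : ℝ) ^ (1 + Φ.Δ * cS0 Φ t D mk + cS0 Φ t D mk * KS.cUA Φ t D mk)) ^ kk0 κ Φ t p D mk ≤ δ' ∧
      1 / (1 - (q : ℝ)) ^ (Φ.Δ * Nk0 κ Φ t p D mk) ≤ δ' * ((Finset.Icc (j₀0 t D mk) (j₁0 κ Φ t p D mk)).card : ℝ) := by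
  obtain ⟨hk, hc⟩ := BoxProdZ2.kit_counts_at_le Φ.Δ (sB0 Φ t D mk) (B0 Φ t D mk) (Neg.δkit_pos κ Φ) hδ' p hp0 hp1 hq1 hq2
  rw [card_levels κ Φ t p D mk hp0 hp1]
  exact ⟨hk, hc _ le_rfl⟩

/-- **The counts at the ROOT accuracy `κ.δr 0`** (the root leg's `hk/hcount`; `δkit ≤ δr 0`). [folklore] -/
theorem counts_atq_root (hp0 : 0 < (p : ℝ)) (hp1 : (p : ℝ) < 1) {q : unitInterval} (hq1 : (p : ℝ) / 2 ≤ q) (hq2 : (q : ℝ) ≤ p) :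
    (1 - (q : ℝ) ^ (1 + Φ.Δ * cS0 Φ t D mk + cS0 Φ t D mk * KS.cUA Φ t D mk)) ^ kk0 κ Φ t p D mk ≤ κ.δr 0 ∧
      1 / (1 - (q : ℝ)) ^ (Φ.Δ * Nk0 κ Φ t p D mk) ≤ κ.δr 0 * ((Finset.Icc (j₀0 t D mk) (j₁0 κ Φ t p D mk)).card : ℝ) :=
  counts_atq κ Φ t p D mk hp0 hp1 hq1 hq2 (Neg.δkit_le_δr κ Φ (by norm_num))

/-- **The counts at the face accuracy `κ.δ₂`** (`δkit ≤ δ₂`). [folklore] -/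
theorem counts_atq_face (hp0 : 0 < (p : ℝ)) (hp1 : (p : ℝ) < 1) {q : unitInterval} (hq1 : (p : ℝ) / 2 ≤ q) (hq2 : (q : ℝ) ≤ p) :
    (1 - (q : ℝ) ^ (1 + Φ.Δ * cS0 Φ t D mk + cS0 Φ t D mk * KS.cUA Φ t D mk)) ^ kk0 κ Φ t p D mk ≤ κ.δ₂ ∧
      1 / (1 - (q : ℝ)) ^ (Φ.Δ * Nk0 κ Φ t p D mk) ≤ κ.δ₂ * ((Finset.Icc (j₀0 t D mk) (j₁0 κ Φ t p D mk)).card : ℝ) :=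
  counts_atq κ Φ t p D mk hp0 hp1 hq1 hq2 (Neg.δkit_le_δ₂ κ Φ)

/-- **The reach fits under `Rlev0`**: `j ≤ j₁0 → j + reach0 ≤ Rlev0` (the `hE` row for every frame with `R′ ≥ Rlev0`). [folklore] -/
theorem j_reach_le {j : ℕ} (hj : j ≤ j₁0 κ Φ t p D mk) : j + reach0 t D mk ≤ Rlev0 κ Φ t p D mk := by unfold Rlev0; omega

/-- `R′0 = j₁0 + reach0 + 1`, `Rlev0 + 1 = R′0`, `j₁0 ≤ Rlev0`. [folklore] -/
theorem R'0_eq : R'0 κ Φ t p D mk = j₁0 κ Φ t p D mk + reach0 t D mk + 1 ∧ Rlev0 κ Φ t p D mk + 1 = R'0 κ Φ t p D mk ∧ j₁0 κ Φ t p D mk ≤ Rlev0 κ Φ t p D mk :=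
  ⟨rfl, rfl, Nat.le_add_right _ _⟩

/-- `T0 < R′0`, `Rs + 2 < R′0`, `reach0 < R′0`, `1 ≤ R′0`. [folklore] -/
theorem T0_lt_R'0 : T0 t D mk < R'0 κ Φ t p D mk ∧ KS.Rs t D mk + 2 < R'0 κ Φ t p D mk ∧ reach0 t D mk < R'0 κ Φ t p D mk ∧ 1 ≤ R'0 κ Φ t p D mk := by
  have h1 : 13 * (T0 t D mk + 1) ≤ reach0 t D mk := by unfold reach0; omega
  have h2 := T0_eq' t D mk
  have h3 := KS.hDρ_at t D mk
  unfold R'0 Rlev0; omega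

end Counts

end KS0

end NegB

end PlanarSkeletonFrmFrom

end Summit.CriticalPhenomena.PercolationContinuityZ3.Theorems.Transplant

end
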